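import Summits.Schanuel.Schanuel.Theorems.RootDecomp1KResidueDescent02

/-!
# RootDecomp1KResidueDescent — lens 1, generation 68, NODE 28 «DESCENT INTO THE SECTOR — BOTH RESIDUE EXHIBITS OF RECORD DECIDED» (×0-AS-RECORD, PRICE L3059; ERRATUM E5; CLAIM L3057, NODE L3068, VERDICT L3071): `thinFibreAt_rho1` / `levelFinite_rho1` (no level point at ANY N ≥ 4 — bi-pure gcd descent + the digit mod 32; family `quartC c = Y⁴ + x·Y − c·x²`, c an odd prime ≢ 1 mod 32) and `thinFibreAt_rho2` / `levelFinite_rho2` (descent onto the x-LINEAR auxiliaries `17Y⁴ + Y³ − x`, `Y⁴ + Y³ − 17³·x`, decided by the TREE's `levelFinite_xLinear` ← node 2's `thinFibreAt_xLinear`; family `bisqC c = (Y² − c·x)² − x·Y`), and the typed NOT-BI-PURE nominees `residue_rho1'` / `residue_rho2'` (ρ1′ = Y⁴ + Y³ + x·Y + x − 17x², ρ2′ = (Y² − 17x)² − x·Y − x) — continuation (RootDecomp1KResidueDescent03): # The x-linear input BY TREE NAME: `RootDecomp1KXLinear.thinFibreAt_xLinear` (XLinear05) at quality `0` · # (D2)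 THE STRATUM-ρ2 EXHIBIT OF RECORD `rho2 = (Y² − 17x)² − x·Y`, DECIDED · # Sanity instance (PRICE L3059): the level-`m = 8` integer point of the ρ2 equation and its descent parameter · §7  (D4) THE REPLACEMENT EXHIBITS ρ1′, ρ2′ — TYPED `Residue 2` MEMBERS, NOT BI-PURE (descent-immune) · # ρ1′ = `Y⁴ + Y³ + x·Y + x − 17·x²` — 26 declarations `bound_two` … `rho1'_axisY_two_monomials`

(lens-1 g68 NODE 28 «DESCENT INTO THE SECTOR» L3068: HOME kernel K = HOME/decomp-schanuel-lens-1/g68/lean/ResidueDescent.lean sha256 7ab17922…, 1232 l, 74 decls (70 theorems + 4 defs), ONE namespace `Summit.Schanuel.Schanuel.Theorems.RootDecomp1KResidueDescent`, imports the tree port …RootDecomp1KSectorTheorem10 ONLY (node 27's THEOREM ×1 port; `rho1` / `rho2` / `Residue` / `SectorCond` / `exists_fourth_root_seventeen` / `exists_sqrt_seventeen` / `levelFinite_xLinear` / `levelFinite_of_thinFibreAt_zero` BY TREE NAME); no private / instance / set_option / notation / sorry / new axiom / binder, `decide` only on ZMod 32 / small literals; lens farm rc 0 · 0 errors · 0 sorries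 · 74 dupNamespace, `--axioms` standard on 17 names, Probe g68/out/Probe.lean 9038b768… rc 0, memo g68/NODE-g68.md 3833b29f…; CLAIM L3057 (ASK-FIRST under K-R58 (iii)); crit g12 PRICE L3059: ×0-AS-RECORD («the levers are bi-pure DESCENT ∪ LOCAL SIEVING mod 32 (ρ1) ∪ the EDGE ENGINE BY NAME (ρ2)»), correction e28-pre-1 (the w = 289 auxiliary `Y⁴ + Y³ − 17³·x`, ADOPTED by the lens), CHECKLIST K-g68 (D1)–(D5) + (S), ERRATUM E5 PRE-ANNOUNCED (exhibits of record must be typed-Residue AND not toolkit-decided, in particular NOT bi-pure; rho1 / rho2 leave the exhibit list and join the unconditional part; exhibits := ∅ until ρ1′ / ρ2′ are certified); writer g35 pre-check NOTE 1 L3060; census LIVENESS-v38 (key bipure: rho1 / rho2 bi-pure, ρ1′ / ρ2′ not; key edge on the nominees: ρ1 / ρ2 by the recipe); crit g12 VERDICT L3071 (04:51Z): ×0-AS-RECORD BOOKED (CHECKLIST K-g68 (D1)–(D4) + (S) met on the critic's own farm runs; (D5) declined-as-typed, families instead), TALLY UNCHANGED lens-1 ×22 + THEOREM ×24, ERRATUM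 E5 FIXED (PRICE L3059 (E5-a)–(E5-d) verbatim; instantiation: toolkit ∪= bi-pure descent; rho1 / rho2 leave the exhibit list and join the unconditional part; exhibits of record := ρ1′ / ρ2′ effective at port landing; ledger and non-dominant territory unchanged), W-28-1 (typed (T♭) welcome, ×0), PORT GO → census-1 (this port; PORT IDENTITY 28 owed by the seated critic). Port by census-1 gen 25 as `RootDecomp1KResidueDescent01–04` (files ≤ 400 lines; `--supports stmt-Schanuel-33364`, the item stays OPEN; ×0 record port, no credit anywhere; E5: UNCONDITIONAL PART ∪= these names): 01 = K l.1–378 of the prepped source (opens §0 / §1 / §2 / §3) — 20 decls `quartC`, `bisqC`, `rho1_eq_quartC`, …, `int_eq4`; 02 = K l.379–693 of the prepped source (opens §4 / §5 / §6) — 17 decls `shape4`, `level_exponent`, `two_pow_dvd_psNumer_sub_one`, …, `bound_one`; 03 = K l.694–941 of the prepped source (opens # The x-linear input BY TREE NAME: `RootDecomp1KXLinear.thinFibreAt_xLinear` (XLinear05) at quality `0` / # (D2) THE STRATUM-ρ2 EXHIBIT OF RECORD `rho2 = (Y² − 17x)² − x·Y`, DECIDED / # Sanity instance (PRICE L3059):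 the level-`m = 8` integer point of the ρ2 equation and its descent parameter / §7 / # ρ1′ = `Y⁴ + Y³ + x·Y + x − 17·x²`) — 26 decls `bound_two`, `three_le_abs`, `aeval_aux₁`, …, `rho1'_axisY_two_monomials`; 04 = K l.942–1253 of the prepped source (opens # ρ2′ = `(Y² − 17x)² − x·Y − x`) — 11 decls `residue_rho1'`, `sectorCond_rho1'`, `rho2'`, …, `nominees`. 22 one-line docstrings synthesised for undocumented helper declarations (statements quoted); everything else = K VERBATIM (statements, names, proofs, K's module docstring kept in part 01 below this provenance block).)
-/

noncomputable section

namespace Summit.Schanuel.Schanuel.Theorems.RootDecomp1KResidueDescent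

open Polynomial LiouvilleNumber
open scoped Nat
open Summit.Schanuel.Schanuel.Theorems.RootDecomp1KTwoBaseCell (psNumer partialSum_eq_psNumer_div coprime_psNumer)
open Summit.Schanuel.Schanuel.Theorems.RootDecomp1KDegreeLadder
open Summit.Schanuel.Schanuel.Theorems.RootDecomp1KXLinear (xLinP bev_xLinP thinFibreAt_xLinear)
open Summit.Schanuel.Schanuel.Theorems.RootDecomp1KXTop
open Summit.Schanuel.Schanuel.Theorems.RootDecomp1KLevelFinite
open Summit.Schanuel.Schanuel.Theorems.RootDecomp1KOddEmpty (levelFinite_of_no_level)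
open Summit.Schanuel.Schanuel.Theorems.RootDecomp1KHeightGrading (BddLevelEmpty bddLevelEmpty_iff_levelFinite)
open Summit.Schanuel.Schanuel.Theorems.RootDecomp1KDigitPincer (odd_psNumer_two two_pow_dvd_of_dvd_mul_odd)
open Summit.Schanuel.Schanuel.Theorems.RootDecomp1KTrinomialDescent (partialSum_two_eq_int_div)
open Summit.Schanuel.Schanuel.Theorems.RootDecomp1KRunge (psNumer_pos_runge)
open Summit.Schanuel.Schanuel.Theorems.RootDecomp1KLocalExponent (rootMult)
open Summit.Schanuel.Schanuel.Theorems.RootDecomp1KSectorTheorem (Residue SectorCond EdgeGood TopWeight RootGood layerPoly supp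
  layerPoly_eq_sum mem_supp_of aeval_eq_eval_map rho1 rho2 rho1_zero rho1_one rho1_two rho2_zero rho2_one rho2_two
  aeval_intCast_padicInt exists_padicInt_root exists_fourth_root_seventeen exists_sqrt_seventeen
  levelFinite_of_thinFibreAt_zero levelFinite_xLinear)

/-- archimedean bookkeeping, branch `w = c²`: `c³·p = a³(a + T)`, `0 < p < 2T⁴`, `|c| ≥ 1` ⟹ `|a| ≤ 2|c|·T`. -/
theorem bound_two {c a T p : ℤ} (hc1 : 1 ≤ |c|) (hT : 0 < T) (hp : c ^ 3 * p = a ^ 3 * (a + T)) (hp0 : 0 < p)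
    (hplt : p < 2 * T ^ 4) : |a| ≤ 2 * |c| * T := by
  by_contra H
  push Not at H
  have hK : 2 * T ≤ 2 * |c| * T := by nlinarith
  have h2T : 2 * T < |a| := lt_of_le_of_lt hK H
  have h1 : |a| - T ≤ |a + T| := by
    have := abs_sub_abs_le_abs_sub a (-T)
    rwa [abs_neg, abs_of_pos hT, sub_neg_eq_add] at this
  have h2 : |a| < 2 * |a + T| := by linarith
  have h3 : |c| ^ 3 * p = |a| ^ 3 * |a + T| := by
    have e := congrArg abs hp
    simp only [abs_mul, abs_pow, abs_of_pos hp0] at e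
    exact e
  have ha0 : 0 < |a| := by linarith
  have h4 : |a| ^ 4 < 2 * (|c| ^ 3 * p) := by
    rw [h3]
    have ha3 : 0 < |a| ^ 3 := by positivity
    nlinarith
  have h5 : (2 * |c| * T) ^ 4 < |a| ^ 4 := pow_lt_pow_left₀ H (by positivity) (by norm_num)
  have h6 : |c| ^ 3 * p < |c| ^ 3 * (2 * T ^ 4) := mul_lt_mul_of_pos_left hplt (by positivity)
  have h7 : (2 * |c| * T) ^ 4 = 16 * |c| ^ 4 * T ^ 4 := by ring
  have h8 : 16 * |c| ^ 4 * T ^ 4 < 4 * |c| ^ 3 * T ^ 4 := by linarith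
  have h9 : 0 ≤ 4 * |c| ^ 3 * T ^ 4 * (4 * |c| - 1) :=
    mul_nonneg (by positivity) (by linarith)
  nlinarith

/-- `|c| ≥ 3` for an odd prime `c`. -/
theorem three_le_abs {c : ℤ} (hc : Prime c) (hodd : Odd c) : 3 ≤ |c| := by
  have h2 : 2 ≤ c.natAbs := (Int.prime_iff_natAbs_prime.mp hc).two_le
  have hne : c.natAbs ≠ 2 := by
    intro h
    have : Even c := by
      rcases Int.natAbs_eq_iff.mp h with h' | h' <;> rw [h'] <;> decide
    exact Int.not_even_iff_odd.mpr hodd this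
  have h3 : 3 ≤ c.natAbs := by omega
  rw [Int.abs_eq_natAbs]; exact_mod_cast h3

/-- `(c : ℤ) (t : ℝ) : aeval t (C c * X ^ 4 + X ^ 3 : ℤ[X]) = c * t ^ 4 + t ^ 3`. -/
theorem aeval_aux₁ (c : ℤ) (t : ℝ) : aeval t (C c * X ^ 4 + X ^ 3 : ℤ[X]) = c * t ^ 4 + t ^ 3 := by simp

/-- `(t : ℝ) : aeval t (X ^ 4 + X ^ 3 : ℤ[X]) = t ^ 4 + t ^ 3`. -/
theorem aeval_aux₂ (t : ℝ) : aeval t (X ^ 4 + X ^ 3 : ℤ[X]) = t ^ 4 + t ^ 3 := by simp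

/-- `(n : ℤ) (t : ℝ) : aeval t (C n : ℤ[X]) = n`. -/
theorem aeval_C_int (n : ℤ) (t : ℝ) : aeval t (C n : ℤ[X]) = n := by simp

/-- **THE TRANSPORT**: a level point of `R₂(c)` at a level `N ≥ 4` yields a level point (same level, height `≤ 1`
resp. `≤ 2|c|`, denominator `2^{N!/4}`) of the x-LINEAR presentation `c·Y⁴ + Y³ − x` or `Y⁴ + Y³ − c³·x`. -/
theorem level_transport_bisqC {c : ℤ} (hc : Prime c) (hodd : Odd c) {N : ℕ} (hN : 4 ≤ N) {r : ℚ}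
    (h : bev (xPolyP 2 (bisqC c)) (partialSum 2 N) r = 0) :
    N ∈ LevelSet (xLinP (C c * X ^ 4 + X ^ 3) (C (-1))) 1 ∨
      N ∈ LevelSet (xLinP (X ^ 4 + X ^ 3) (C (-c ^ 3))) (2 * |(c : ℝ)|) := by
  obtain ⟨m, hNm, hm1, -, h4⟩ := level_exponent (show 2 ≤ N by omega)
  obtain ⟨-, ⟨k, hk⟩⟩ := h4 hN
  set p : ℤ := (psNumer 2 N : ℤ) with hpdef
  have hp_odd : Odd p := odd_psNumer_two (by omega)
  have hp0 : 0 < p := psNumer_two_pos_int N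
  have hT4 : (2 : ℤ) ^ N ! = (2 ^ k) ^ 4 := by rw [hNm, hk, ← pow_mul]; ring_nf
  have hplt : p < 2 * (2 ^ k) ^ 4 := by rw [← hT4]; exact psNumer_two_lt_int N
  have hT : (0 : ℤ) < 2 ^ k := by positivity
  have hx : partialSum 2 N = (p : ℝ) / 2 ^ (2 * m) := by rw [partialSum_two_eq_int_div, hNm]
  have hxR : partialSum 2 N = (p : ℝ) / ((2 : ℝ) ^ k) ^ 4 := by
    rw [hx, hk]; ring
  rw [bev_bisqC, hx] at h
  have hint := int_eq4 (-(2 * c)) (-1) (c ^ 2) p m r (by push_cast; linear_combination h)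
  obtain ⟨-, -, hred⟩ := shape4 (by exact hodd.pow) hp_odd hm1 hint
  rw [hk] at hred
  obtain ⟨a, hcase⟩ := core_bisq hc hodd hp0 (W := r.num) (h := k) (by linear_combination hred)
  have h2k : ((2 : ℝ) ^ k) ≠ 0 := pow_ne_zero _ two_ne_zero
  have htcast : (((a : ℚ) / 2 ^ k : ℚ) : ℝ) = (a : ℝ) / 2 ^ k := by push_cast; rfl
  rcases hcase with hp_eq | hp_eq
  · left
    refine ⟨(a : ℚ) / 2 ^ k, ?_, ?_, ?_⟩
    · -- height: |a| ≤ 2^k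
      have hb := bound_one (three_le_abs hc hodd) hT hp_eq hp0 hplt
      have hb' : |(a : ℝ)| ≤ (2 : ℝ) ^ k := by exact_mod_cast hb
      rw [htcast, abs_div, abs_of_pos (by positivity : (0 : ℝ) < 2 ^ k), div_le_one (by positivity)]
      exact hb'
    · -- the level equation of c·Y⁴ + Y³ − x at (s_N, a/2^k)
      rw [bev_xLinP, aeval_aux₁, aeval_C_int, hxR, htcast]
      have e : (p : ℝ) = (a : ℝ) ^ 3 * (c * a + 2 ^ k) := by exact_mod_cast hp_eq
      have e' : (p : ℝ) / ((2 : ℝ) ^ k) ^ 4 = c * ((a : ℝ) / 2 ^ k) ^ 4 + ((a : ℝ) / 2 ^ k) ^ 3 := by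
        rw [e]; field_simp
      push_cast
      linear_combination -e'
    · -- non-degenerate: x ↦ A(t) − x is not identically zero
      refine ⟨aeval (((a : ℚ) / 2 ^ k : ℚ) : ℝ) (C c * X ^ 4 + X ^ 3 : ℤ[X]) + 1, ?_⟩
      rw [bev_xLinP, aeval_C_int]
      push_cast
      intro h0
      linarith
  · right
    refine ⟨(a : ℚ) / 2 ^ k, ?_, ?_, ?_⟩
    · have hc1 : 1 ≤ |c| := le_trans (by norm_num) (three_le_abs hc hodd)
      have hb := bound_two hc1 hT hp_eq hp0 hplt
      have hb' : |(a : ℝ)| ≤ 2 * |(c : ℝ)| * (2 : ℝ) ^ k := by exact_mod_cast hb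
      rw [htcast, abs_div, abs_of_pos (by positivity : (0 : ℝ) < 2 ^ k), div_le_iff₀ (by positivity)]
      exact hb'
    · rw [bev_xLinP, aeval_aux₂, aeval_C_int, hxR, htcast]
      have e : (c : ℝ) ^ 3 * (p : ℝ) = (a : ℝ) ^ 3 * (a + 2 ^ k) := by exact_mod_cast hp_eq
      have e' : (c : ℝ) ^ 3 * ((p : ℝ) / ((2 : ℝ) ^ k) ^ 4) = ((a : ℝ) / 2 ^ k) ^ 4 + ((a : ℝ) / 2 ^ k) ^ 3 := by
        rw [mul_div_assoc', e]; field_simp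
      push_cast
      linear_combination -e'
    · refine ⟨(aeval (((a : ℚ) / 2 ^ k : ℚ) : ℝ) (X ^ 4 + X ^ 3 : ℤ[X]) + 1) / c ^ 3, ?_⟩
      have hc0 : (c : ℝ) ≠ 0 := by exact_mod_cast hc.ne_zero
      rw [bev_xLinP, aeval_C_int]
      push_cast
      rw [show ∀ u : ℝ, u + (u + 1) / (c : ℝ) ^ 3 * -((c : ℝ) ^ 3) = -1 from fun u => by field_simp; ring]
      norm_num

/-- **`LevelFinite (R₂(c))` MODULO the x-linear finiteness of its two auxiliaries** (both instances of node 27's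
`levelFinite_xLinear`: `deg B + 2 = 2 ≤ 4 = deg A`). -/
theorem levelFinite_bisqC_of {c : ℤ} (hc : Prime c) (hodd : Odd c)
    (h₁ : LevelFinite (xLinP (C c * X ^ 4 + X ^ 3) (C (-1))))
    (h₂ : LevelFinite (xLinP (X ^ 4 + X ^ 3) (C (-c ^ 3)))) : LevelFinite (xPolyP 2 (bisqC c)) := by
  intro C0
  refine (((Set.finite_lt_nat 4).union (h₁ 1)).union (h₂ (2 * |(c : ℝ)|))).subset ?_
  rintro N ⟨r, -, hP, -⟩
  by_cases hN : N < 4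
  · exact Or.inl (Or.inl hN)
  · rcases level_transport_bisqC hc hodd (by omega) hP with h | h
    · exact Or.inl (Or.inr h)
    · exact Or.inr h

/-- (D3) the LEVEL ↦ AUXILIARY-LEVEL MAP in `LevelSet` form: every level of `R₂(c)` (any height `C`) is `< 4` or a
level of one of the two x-linear auxiliaries at the FIXED heights `1`, `2|c|`. -/
theorem levelSet_bisqC_subset {c : ℤ} (hc : Prime c) (hodd : Odd c) (C0 : ℝ) :
    LevelSet (xPolyP 2 (bisqC c)) C0 ⊆ {N | N < 4} ∪ LevelSet (xLinP (C c * X ^ 4 + X ^ 3) (C (-1))) 1 ∪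
      LevelSet (xLinP (X ^ 4 + X ^ 3) (C (-c ^ 3))) (2 * |(c : ℝ)|) := by
  rintro N ⟨r, -, hP, -⟩
  by_cases hN : N < 4
  · exact Or.inl (Or.inl hN)
  · rcases level_transport_bisqC hc hodd (by omega) hP with h | h
    · exact Or.inl (Or.inr h)
    · exact Or.inr h

/-! ### The x-linear input BY TREE NAME: `RootDecomp1KXLinear.thinFibreAt_xLinear` (XLinear05) at quality `0` -/

/-! (`ThinFibreAt 0 P → LevelFinite P` and node 27's F4 (α) at quality 0, `LevelFinite (A + x·B)` for `B ≠ 0`,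
`deg B + 2 ≤ deg A` — HYPOTHESIS-FREE, resting on the tree's `RootDecomp1KXLinear.thinFibreAt_xLinear` and the PROVED
`Ridout.padicRoth_int` — are the TREE's `levelFinite_of_thinFibreAt_zero` / `levelFinite_xLinear` (node 27 K §XV, port
part 10), used BY NAME below.) -/

/-- `{c : ℤ} (hc : c ≠ 0) : (C c * X ^ 4 + X ^ 3 : ℤ[X]).natDegree = 4`. -/
theorem natDegree_aux₁ {c : ℤ} (hc : c ≠ 0) : (C c * X ^ 4 + X ^ 3 : ℤ[X]).natDegree = 4 := by
  have h1 : (C c * X ^ 4 : ℤ[X]).natDegree = 4 := natDegree_C_mul_X_pow 4 c hc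
  have h2 : (X ^ 3 : ℤ[X]).natDegree < (C c * X ^ 4 : ℤ[X]).natDegree := by rw [h1, natDegree_X_pow]; norm_num
  rw [natDegree_add_eq_left_of_natDegree_lt h2, h1]

/-- `: (X ^ 4 + X ^ 3 : ℤ[X]).natDegree = 4`. -/
theorem natDegree_aux₂ : (X ^ 4 + X ^ 3 : ℤ[X]).natDegree = 4 := by
  have h2 : (X ^ 3 : ℤ[X]).natDegree < (X ^ 4 : ℤ[X]).natDegree := by rw [natDegree_X_pow, natDegree_X_pow]; norm_num
  rw [natDegree_add_eq_left_of_natDegree_lt h2, natDegree_X_pow]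

/-- the auxiliary `c·Y⁴ + Y³ − x` is LEVEL-FINITE (tree x-linear thin fibre at quality 0). -/
theorem levelFinite_aux₁ {c : ℤ} (hc : c ≠ 0) : LevelFinite (xLinP (C c * X ^ 4 + X ^ 3) (C (-1))) :=
  levelFinite_xLinear _ _ (C_ne_zero.mpr (by norm_num)) (by rw [natDegree_C, natDegree_aux₁ hc]; norm_num)

/-- the auxiliary `Y⁴ + Y³ − c³·x` is LEVEL-FINITE (tree x-linear thin fibre at quality 0). -/
theorem levelFinite_aux₂ {c : ℤ} (hc : c ≠ 0) : LevelFinite (xLinP (X ^ 4 + X ^ 3) (C (-c ^ 3))) :=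
  levelFinite_xLinear _ _ (C_ne_zero.mpr (neg_ne_zero.mpr (pow_ne_zero _ hc)))
    (by rw [natDegree_C, natDegree_aux₂]; norm_num)

/-- **`LevelFinite (R₂(c))` for every odd prime `c` — HYPOTHESIS-FREE.** -/
theorem levelFinite_bisqC {c : ℤ} (hc : Prime c) (hodd : Odd c) : LevelFinite (xPolyP 2 (bisqC c)) :=
  levelFinite_bisqC_of hc hodd (levelFinite_aux₁ hc.ne_zero) (levelFinite_aux₂ hc.ne_zero)

/-- **`ThinFibreAt m₀ (R₂(c))` for EVERY `m₀` — HYPOTHESIS-FREE.** -/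
theorem thinFibreAt_bisqC {c : ℤ} (hc : Prime c) (hodd : Odd c) (m₀ : ℕ) : ThinFibreAt m₀ (xPolyP 2 (bisqC c)) :=
  thinFibreAt_of_levelFinite (levelFinite_bisqC hc hodd) m₀

/-! ### (D2) THE STRATUM-ρ2 EXHIBIT OF RECORD `rho2 = (Y² − 17x)² − x·Y`, DECIDED -/

/-- (D3 for ρ2) the level ↦ auxiliary-level map: auxiliaries of record `17·Y⁴ + Y³ − x` (height `1`) and
`Y⁴ + Y³ − 4913·x` (height `34 ≥ 11`; both signs of `t` admitted, so no `±` variants are needed). -/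
theorem levelSet_rho2_subset (C0 : ℝ) :
    LevelSet (xPolyP 2 rho2) C0 ⊆ {N | N < 4} ∪ LevelSet (xLinP (C 17 * X ^ 4 + X ^ 3) (C (-1))) 1 ∪
      LevelSet (xLinP (X ^ 4 + X ^ 3) (C (-17 ^ 3))) (2 * |((17 : ℤ) : ℝ)|) := by
  rw [rho2_eq_bisqC]; exact levelSet_bisqC_subset prime_seventeen (by decide) C0

/-- the explicit-hypothesis form (the two auxiliaries as named inputs). -/
theorem levelFinite_rho2_of (h₁ : LevelFinite (xLinP (C 17 * X ^ 4 + X ^ 3) (C (-1))))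
    (h₂ : LevelFinite (xLinP (X ^ 4 + X ^ 3) (C (-17 ^ 3)))) : LevelFinite (xPolyP 2 rho2) := by
  rw [rho2_eq_bisqC]; exact levelFinite_bisqC_of prime_seventeen (by decide) h₁ h₂

/-- **`LevelFinite rho2` — HYPOTHESIS-FREE** (descent transport + the tree's x-linear thin fibre at quality 0). -/
theorem levelFinite_rho2 : LevelFinite (xPolyP 2 rho2) := by
  rw [rho2_eq_bisqC]; exact levelFinite_bisqC prime_seventeen (by decide)

/-- `: BddLevelEmpty (xPolyP 2 rho2)`. -/
theorem bddLevelEmpty_rho2 : BddLevelEmpty (xPolyP 2 rho2) :=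
  (bddLevelEmpty_iff_levelFinite _).mpr levelFinite_rho2

/-- **`ThinFibreAt m₀ rho2` for EVERY `m₀` — HYPOTHESIS-FREE** (incl. the residue qualities `m₀ ≤ 2` of node 27's
`residue_rho2`: the exhibit is a TRUE first-order-residue member AND decided). -/
theorem thinFibreAt_rho2 (m₀ : ℕ) : ThinFibreAt m₀ (xPolyP 2 rho2) :=
  thinFibreAt_of_levelFinite levelFinite_rho2 m₀

/-- `: ThinFibreAt 2 (xPolyP 2 rho2)`. -/
theorem thinFibreAt_two_rho2 : ThinFibreAt 2 (xPolyP 2 rho2) := thinFibreAt_rho2 2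

/-! ### Sanity instance (PRICE L3059): the level-`m = 8` integer point of the ρ2 equation and its descent parameter -/

/-- the integer point `(W, p) = (721, 35329 = 7³·103)` of `(W² − 17p)² = p·2^8·W` (`2h = 8`, `T = 2^4`), its descent
parameter `a = −7` (branch `w = 1`: `p = a³(17a + T)`), and the auxiliary level point `t = a/T = −7/16` of
`17·Y⁴ + Y³ − x` at `x = p/T⁴`. -/
example : ((721 : ℤ) ^ 2 - 17 * 35329) ^ 2 = 35329 * 2 ^ 8 * 721 ∧ (35329 : ℤ) = 7 ^ 3 * 103 ∧
    (35329 : ℤ) = (-7) ^ 3 * (17 * (-7) + 2 ^ 4) ∧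
    (17 : ℚ) * (-7 / 16) ^ 4 + (-7 / 16) ^ 3 = 35329 / (2 ^ 4) ^ 4 := by norm_num

/-! ## §7  (D4) THE REPLACEMENT EXHIBITS ρ1′, ρ2′ — TYPED `Residue 2` MEMBERS, NOT BI-PURE (descent-immune)

After this node the two exhibits of record are DECIDED; K-R58 (ii) wants toolkit-UNDECIDED exhibits.  The nominees
`ρ1′ := Y⁴ + Y³ + x·Y + x − 17·x²` (stratum ρ1: same violating edge `2/4`, same edge polynomial `W⁴ − 17`, simple
`ℚ₂`-root `17^{1/4}`, first non-vanishing layer `f₂ = W³ + W`, `f₂(β) = β(β² + 1) ≠ 0`, `G_eff = 2 = s`) and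
`ρ2′ := (Y² − 17x)² − x·Y − x` (stratum ρ2: edge `1/2`, `f = (W² − 17)²`, `μ = 2`, `μ·s = 2 ≥ q = 2`) are typed here
against the TREE's predicate `RootDecomp1KSectorTheorem.Residue` (node 27, part 01), each with its vacuous complement
`SectorCond m₀` for `m₀ ≥ 3`, and with the decidable coefficient facts that make them NOT BI-PURE: `ρ1′(0, Y) = Y⁴ + Y³`
and `ρ2′(x, 0) = 289x² − x` are not monomials, so the cleared level equation has no `rad p ∣ W` split and §2–§6 do not
start.  (NOT claimed: that ρ1′ / ρ2′ are undecidable by other toolkit members — «toolkit-undecided as far as the record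
knows», K-R58 (ii) (d0′).) -/

/-! ### ρ1′ = `Y⁴ + Y³ + x·Y + x − 17·x²` -/

/-- the x-coefficient vector of the NOMINEE ρ1′: `c₀ = Y⁴ + Y³`, `c₁ = Y + 1`, `c₂ = −17`. -/
def rho1' (j : ℕ) : ℤ[X] :=
  if j = 0 then X ^ 4 + X ^ 3 else if j = 1 then X + C 1 else if j = 2 then C (-17) else 0

/-- `: rho1' 0 = X ^ 4 + X ^ 3`. -/
theorem rho1'_zero : rho1' 0 = X ^ 4 + X ^ 3 := by simp [rho1']
/-- `: rho1' 1 = X + C 1`. -/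
theorem rho1'_one : rho1' 1 = X + C 1 := by simp [rho1']
/-- `: rho1' 2 = C (-17)`. -/
theorem rho1'_two : rho1' 2 = C (-17) := by simp [rho1']

/-- `ρ1′(x, y) = y⁴ + y³ + x·y + x − 17·x²`. -/
theorem bev_rho1' (x y : ℝ) : bev (xPolyP 2 rho1') x y = y ^ 4 + y ^ 3 + x * y + x - 17 * x ^ 2 := by
  rw [bev_xPolyP]
  simp [Finset.sum_range_succ, rho1'_zero, rho1'_one, rho1'_two, map_ofNat]
  ring

/-- **ρ1′ is NOT BI-PURE** (descent-immune): `ρ1′(0, Y) = c₀ = Y⁴ + Y³` carries two monomials. -/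
theorem rho1'_axisY_two_monomials : (rho1' 0).coeff 4 ≠ 0 ∧ (rho1' 0).coeff 3 ≠ 0 := by
  rw [rho1'_zero, coeff_add, coeff_add, coeff_X_pow, coeff_X_pow, coeff_X_pow, coeff_X_pow]; norm_num

end Summit.Schanuel.Schanuel.Theorems.RootDecomp1KResidueDescent
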